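import Summits.AtomisticToContinuum.Crystallization.Theorems.HullExactificationCascadeZeroDefectDensityCoordsHcpGood
import Summits.AtomisticToContinuum.Crystallization.Theorems.HullExactificationCascadeZeroDefectDensityCoordsHcpBad
import HarnessLib

/-!
# Coordinates for the birth line of `ZeroDefectDensity` — IV: the registered stub `stub_coordsHcp`
# (route `HullExactificationCascade`, crux `ZeroDefectDensity`, stmt-AtomisticToContinuum-12086; line `birth`)

Registered stub `stub_coordsHcp` of the birth skeleton (lead c4), verbatim: twelve points labelled by
the hcp kissing pattern (`Literature.Geometry.DiscreteGeometry.hcpKissingPattern`) with norms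
`1 ± 1/4000` about a centre `u`, contacts `1 ± 1/4000`, square diagonals `|d² - 2| ≤ 38/4000`,
`√3`-pairs `|d² - 3| ≤ 40/4000` and `√(8/3)`-pairs `|d² - 8/3| ≤ 60/4000` admit a linear isometry
`A` with `‖(τ q - u) - A q‖ ≤ 49/1000` for all twelve `q`.

Proof: enumerate the pattern by `hcpTab / √18` (`hcp_chart'`, as in `…CapAtomsPattern`), so that
the pattern types become integer facts; take the Gram–Schmidt frame of `…CoordsHcpGood` and the
linear isometry carrying the coordinate basis to it (`…AsmFrame`); the seven good points are within
`0.013` (`hcp_good` + Parseval) and the five bad ones within `0.049` (`hcp_bad`). [folklore]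
-/

noncomputable section

namespace Summit.AtomisticToContinuum.Crystallization.Theorems.ZeroDefectDensityBirth

open Real RealInnerProductSpace Literature.Geometry.DiscreteGeometry

/-- The enumeration `i ↦ hcpTab i / √18` is a bijection `Fin 12 ≃ hcpKissingPattern` (the chart of
`hcp_chart`, with its formula exposed). [folklore] -/
theorem hcp_chart' : ∃ f : Fin 12 ≃ {q : EuclideanSpace ℝ (Fin 3) // q ∈ hcpKissingPattern},
    ∀ i, (f i).1 = (Real.sqrt 18)⁻¹ • intVec (hcpTab i) := by
  have h18 : (18 : ℕ) ≠ 0 := by norm_num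
  have hmem : ∀ i : Fin 12, (Real.sqrt ((18 : ℕ) : ℝ))⁻¹ • intVec (hcpTab i) ∈ hcpKissingPattern := by
    intro i
    rw [hcpKissingPattern, scaledPattern, hcpInt_eq_image, Finset.image_image]
    exact Finset.mem_image.2 ⟨i, Finset.mem_univ _, rfl⟩
  let g : Fin 12 → {q : EuclideanSpace ℝ (Fin 3) // q ∈ hcpKissingPattern} :=
    fun i => ⟨(Real.sqrt ((18 : ℕ) : ℝ))⁻¹ • intVec (hcpTab i), hmem i⟩
  have hinj : Function.Injective g := fun i j h =>
    hcpTab_injective (scaledPattern_map_injective h18 (congrArg Subtype.val h))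
  have hsurj : Function.Surjective g := by
    rintro ⟨q, hq⟩
    rw [hcpKissingPattern, scaledPattern, hcpInt_eq_image, Finset.image_image] at hq
    obtain ⟨i, -, rfl⟩ := Finset.mem_image.1 hq
    exact ⟨i, rfl⟩
  exact ⟨Equiv.ofBijective g ⟨hinj, hsurj⟩, fun i => rfl⟩

/-- Distances in the chart: `dist (hcpTab i/√18) (hcpTab j/√18) = √(|hcpTab i - hcpTab j|²/18)`.
[folklore] -/
theorem hcp_chart_dist {f : Fin 12 → {q : EuclideanSpace ℝ (Fin 3) // q ∈ hcpKissingPattern}}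
    (hf : ∀ i, (f i).1 = (Real.sqrt 18)⁻¹ • intVec (hcpTab i)) (i j : Fin 12) :
    dist (f i).1 (f j).1 = Real.sqrt ((sqNormInt (hcpTab i - hcpTab j) : ℝ) / 18) := by
  rw [hf i, hf j, dist_eq_norm, ← smul_sub, intVec_sub, norm_smul, norm_inv,
    Real.norm_of_nonneg (Real.sqrt_nonneg _), norm_intVec, Real.sqrt_div' _ (by norm_num),
    inv_mul_eq_div]

/-- **Registered stub `stub_coordsHcp`** of the birth skeleton of `ZeroDefectDensity` (lead c4),
verbatim: a soft hcp shell is within `49/1000` of the hcp pattern under a linear isometry.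
[folklore] -/
theorem stub_coordsHcp : ∀ (u : EuclideanSpace ℝ (Fin 3)) (τ : {q : EuclideanSpace ℝ (Fin 3) // q ∈ Literature.Geometry.DiscreteGeometry.hcpKissingPattern} → EuclideanSpace ℝ (Fin 3)), (∀ q : {q : EuclideanSpace ℝ (Fin 3) // q ∈ Literature.Geometry.DiscreteGeometry.hcpKissingPattern}, 1 - 1 / 4000 ≤ dist u (τ q) ∧ dist u (τ q) ≤ 1 + 1 / 4000) → (∀ q q' : {q : EuclideanSpace ℝ (Fin 3) // q ∈ Literature.Geometry.DiscreteGeometry.hcpKissingPattern}, dist q.1 q'.1 = 1 → 1 - 1 / 4000 ≤ dist (τ q) (τ q') ∧ dist (τ q) (τ q') ≤ 1 + 1 / 4000) → (∀ q q' : {q : EuclideanSpace ℝ (Fin 3) // q ∈ Literature.Geometry.DiscreteGeometry.hcpKissingPattern}, dist q.1 q'.1 = Real.sqrt 2 → |dist (τ q) (τ q') ^ 2 - 2| ≤ 38 / 4000) → (∀ q q' : {q : EuclideanSpace ℝ (Fin 3) // q ∈ Literature.Geometry.DiscreteGeometry.hcpKissingPattern}, dist q.1 q'.1 = Real.sqrt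 3 → |dist (τ q) (τ q') ^ 2 - 3| ≤ 40 / 4000) → (∀ q q' : {q : EuclideanSpace ℝ (Fin 3) // q ∈ Literature.Geometry.DiscreteGeometry.hcpKissingPattern}, dist q.1 q'.1 = Real.sqrt (8 / 3) → |dist (τ q) (τ q') ^ 2 - 8 / 3| ≤ 60 / 4000) → ∃ A : EuclideanSpace ℝ (Fin 3) →ₗᵢ[ℝ] EuclideanSpace ℝ (Fin 3), ∀ q : {q : EuclideanSpace ℝ (Fin 3) // q ∈ Literature.Geometry.DiscreteGeometry.hcpKissingPattern}, ‖(τ q - u) - A q.1‖ ≤ 49 / 1000 := by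
  intro u τ H1 H2 H3 H4 H5
  obtain ⟨f, hf⟩ := hcp_chart'
  have hd := hcp_chart_dist hf
  -- the twelve shell vectors and the metric data, indexed by `Fin 12`
  obtain ⟨p, hp⟩ : ∃ p : Fin 12 → EuclideanSpace ℝ (Fin 3), ∀ i, p i = τ (f i) - u :=
    ⟨_, fun i => rfl⟩
  have hpd : ∀ i j, ‖p i - p j‖ = dist (τ (f i)) (τ (f j)) := fun i j => by
    rw [hp, hp, sub_sub_sub_cancel_right, dist_eq_norm]
  have hn : ∀ i, 1 - 1 / 4000 ≤ ‖p i‖ ∧ ‖p i‖ ≤ 1 + 1 / 4000 := fun i => by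
    rw [hp, ← dist_eq_norm, dist_comm]; exact H1 (f i)
  have h1 : ∀ i j, sqNormInt (hcpTab i - hcpTab j) = 18 →
      1 - 1 / 4000 ≤ ‖p i - p j‖ ∧ ‖p i - p j‖ ≤ 1 + 1 / 4000 := fun i j h => by
    rw [hpd]; exact H2 (f i) (f j) (by rw [hd, h]; norm_num)
  have h2 : ∀ i j, sqNormInt (hcpTab i - hcpTab j) = 36 → |‖p i - p j‖ ^ 2 - 2| ≤ 38 / 4000 :=
    fun i j h => by rw [hpd]; exact H3 (f i) (f j) (by rw [hd, h]; norm_num)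
  have h3 : ∀ i j, sqNormInt (hcpTab i - hcpTab j) = 54 → |‖p i - p j‖ ^ 2 - 3| ≤ 40 / 4000 :=
    fun i j h => by rw [hpd]; exact H4 (f i) (f j) (by rw [hd, h]; norm_num)
  have h83 : ∀ i j, sqNormInt (hcpTab i - hcpTab j) = 48 →
      |‖p i - p j‖ ^ 2 - 8 / 3| ≤ 60 / 4000 :=
    fun i j h => by rw [hpd]; exact H5 (f i) (f j) (by rw [hd, h]; norm_num)
  -- the frame, the orthonormal basis, the isometry
  obtain ⟨b₁, hb₁⟩ : ∃ b : EuclideanSpace ℝ (Fin 3), b = ‖p 6 + p 0‖⁻¹ • (p 6 + p 0) := ⟨_, rfl⟩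
  obtain ⟨b₂, hb₂⟩ : ∃ b : EuclideanSpace ℝ (Fin 3),
      b = ‖(p 6 - p 0) - ⟪p 6 - p 0, b₁⟫ • b₁‖⁻¹ • ((p 6 - p 0) - ⟪p 6 - p 0, b₁⟫ • b₁) := ⟨_, rfl⟩
  obtain ⟨b₃, hb₃⟩ : ∃ b : EuclideanSpace ℝ (Fin 3),
      b = ‖(p 7 - p 2) - ⟪p 7 - p 2, b₁⟫ • b₁ - ⟪p 7 - p 2, b₂⟫ • b₂‖⁻¹ •
        ((p 7 - p 2) - ⟪p 7 - p 2, b₁⟫ • b₁ - ⟪p 7 - p 2, b₂⟫ • b₂) := ⟨_, rfl⟩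
  obtain ⟨hO, P0, P2, P4, P5, P6, P7, P8⟩ := hcp_good hn h1 h2 h3 hb₁ hb₂ hb₃
  obtain ⟨C, hC⟩ := exists_orthonormalBasis_of_orthonormal hO
  obtain ⟨A, hA⟩ := exists_linearIsometry_onb (EuclideanSpace.basisFun (Fin 3) ℝ) C
  have hqB : ∀ (i : Fin 12) (k : Fin 3), ⟪(f i).1, (EuclideanSpace.basisFun (Fin 3) ℝ) k⟫ =
      (Real.sqrt 18)⁻¹ * ((hcpTab i k : ℤ) : ℝ) :=
    hcp_ideal_coord (q := fun i => (f i).1) hf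
  -- the seven good points
  have good : ∀ (i : Fin 12) (T : Fin 3 → ℝ),
      (∀ k, |⟪p i, ![b₁, b₂, b₃] k⟫ - (Real.sqrt 18)⁻¹ * ((hcpTab i k : ℤ) : ℝ)| ≤ T k) →
      ∑ k, T k ^ 2 ≤ 0.013 ^ 2 → ‖p i - A (f i).1‖ ≤ 0.013 := by
    intro i T hT hs
    exact hcp_norm_le_of_forall_coord _ C A hA T (by norm_num) (fun k => by rw [hC, hqB]; exact hT k) hs
  have g0 := good 0 _ P0 (by simp [Fin.sum_univ_three]; norm_num)
  have g2 := good 2 _ P2 (by simp [Fin.sum_univ_three]; norm_num)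
  have g4 := good 4 _ P4 (by simp [Fin.sum_univ_three]; norm_num)
  have g5 := good 5 _ P5 (by simp [Fin.sum_univ_three]; norm_num)
  have g6 := good 6 _ P6 (by simp [Fin.sum_univ_three]; norm_num)
  have g7 := good 7 _ P7 (by simp [Fin.sum_univ_three]; norm_num)
  have g8 := good 8 _ P8 (by simp [Fin.sum_univ_three]; norm_num)
  -- the five bad points
  obtain ⟨N1, N3, N9, N10, N11⟩ :=
    hcp_bad (q := fun i => (f i).1) hn h1 h2 h3 h83 hf hA g0 g2 g4 g5 g6 g7 g8
  -- conclusion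
  refine ⟨A, fun x => ?_⟩
  obtain ⟨i, rfl⟩ := f.surjective x
  rw [← hp]
  have hle : (0.013 : ℝ) ≤ 49 / 1000 := by norm_num
  fin_cases i
  exacts [g0.trans hle, N1, g2.trans hle, N3, g4.trans hle, g5.trans hle, g6.trans hle,
    g7.trans hle, g8.trans hle, N9, N10, N11]

end Summit.AtomisticToContinuum.Crystallization.Theorems.ZeroDefectDensityBirth

end
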